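import Literature.AlgebraicGeometry.Resolution.RelativeCurveChartConstants
import Literature.AlgebraicGeometry.Resolution.HenselizationHenselian
import Literature.AlgebraicGeometry.Resolution.RelativeCurveAmbientHypotheses
import HarnessLib

/-!
# The constants of the chart datum of Thm. 3.3.1 over a purely inseparable level

Topic: `Literature/AlgebraicGeometry/Resolution` (valued fields; field theory). Plumbing for
the assembly of M. Temkin, *Inseparable local uniformization*, J. Algebra 373 (2013) 65–119 =
arXiv:0804.1554v3, Thm. 3.3.1 (tree: `Temkin2013RelativeCurveSmoothFibre`), joining
`RelativeCurveLevelReduction.lean` (the level data `l₀ ≅ lvl ⊆ F₁ = K₁·lvl ⊆ Ω` over which the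
valuative input has trivial purely inseparable part) and `RelativeCurveChartConstants.lean`
(primitive integral constant and Galois hull): the valuative input delivers its separable
constants `Y` as elements of `Ω` separable over `k(S)`, `S ⊆ lvl` the purely inseparable
constants, lying in the henselization of `F₁`; over the COPY `l₀` of the level (an abstract
field mapping onto `lvl`) they are separable, and the primitive `l₀°`-integral constant `y₀`,
`m = l₀(y₀)` and its Galois hull `M` are produced in the shape of the fields `y₀, hy₀V, P,
hPcoef, hy₀int, hy₀sep, hy₀h, m, M, finM, galM, hML, hconjM` of `RelCurveChart`
(`RelativeCurveChartSetup.lean`) for the level data.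

* `isSeparable_of_range_eq` — separability over `k(S)` passes to the copy `l₀` of a level
  `lvl ⊇ S` — PROVED;
* `exists_level_constants` — **the constants over the level** — PROVED;
* `isRankOneValued_fieldRange_level` (the field `hrank`), `sup_le_henselization_closure` (the
  E-side inclusion `F₁ ⊔ m ≤ m(t)^h` from the valuative input's `K₁ ≤ k(S, Y)(t)^h`) —
  bookkeeping — PROVED. (`(algebraMap F Ω).fieldRange = F.toSubfield` for an intermediate field
  `F` is `fieldRange_algebraMap_intermediateField`, `InseparableLocalUniformizationHeightStepTwo.lean`.)

All statements are [folklore]; no definitions, no named facts.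

## Sources

* M. Temkin, arXiv:0804.1554v3, proof of Thm. 3.3.1, Steps 2–3 (the constants). [Temkin2013]
-/

noncomputable section

open Polynomial

namespace Literature.AlgebraicGeometry.Resolution

universe u

variable {k Ω : Type u} [Field k] [Field Ω] [Algebra k Ω]

/-- **Separability over `k(S)` passes to the copy of a level containing `S`.** If `l₀` is a
`k`-algebra mapping into `Ω` onto a set containing `S`, an element of `Ω` separable over
`k(S)` is separable over `l₀`. [folklore] -/
theorem isSeparable_of_range_eq (l₀ : Type u) [Field l₀] [Algebra k l₀] [Algebra l₀ Ω]
    [IsScalarTower k l₀ Ω] (S : Set Ω) (hS : S ⊆ Set.range (algebraMap l₀ Ω)) {y : Ω}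
    (hy : IsSeparable (IntermediateField.adjoin k S) y) : IsSeparable l₀ y := by
  classical
  -- `k(S) → l₀`, compatible with the maps to `Ω`
  have hle : (IntermediateField.adjoin k S : Set Ω) ⊆ Set.range (algebraMap l₀ Ω) := by
    have : IntermediateField.adjoin k S ≤ (IsScalarTower.toAlgHom k l₀ Ω).fieldRange := by
      rw [IntermediateField.adjoin_le_iff]
      intro x hx
      obtain ⟨c, hc⟩ := hS hx
      exact ⟨c, hc⟩
    intro x hx
    obtain ⟨c, hc⟩ := this hx
    exact ⟨c, hc⟩
  have hinj : Function.Injective (algebraMap l₀ Ω) := (algebraMap l₀ Ω).injective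
  let f : IntermediateField.adjoin k S →+* l₀ :=
    { toFun := fun x => (hle x.2).choose
      map_one' := hinj (by rw [(hle (IntermediateField.adjoin k S).one_mem).choose_spec]; simp)
      map_mul' := fun a b => hinj (by
        rw [map_mul, (hle (mul_mem a.2 b.2)).choose_spec, (hle a.2).choose_spec,
          (hle b.2).choose_spec])
      map_zero' := hinj (by rw [(hle (IntermediateField.adjoin k S).zero_mem).choose_spec]; simp)
      map_add' := fun a b => hinj (by
        rw [map_add, (hle (add_mem a.2 b.2)).choose_spec, (hle a.2).choose_spec,
          (hle b.2).choose_spec]) }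
  have hf : ∀ x : IntermediateField.adjoin k S, algebraMap l₀ Ω (f x) = x := fun x =>
    (hle x.2).choose_spec
  have hcomp : (algebraMap l₀ Ω).comp f = algebraMap (IntermediateField.adjoin k S) Ω :=
    RingHom.ext fun x => hf x
  exact isSeparable_of_ringHom_comp_eq f hcomp hy

variable [IsAlgClosed Ω] (V : ValuationSubring Ω)

/-- **The constants over the level.** Data: a `k`-algebra `l₀` (the copy of a finite purely
inseparable level) mapping into `Ω`, its valuation ring `l₀° = V ∩ l₀`, a subfield `F₁ ≤ Ω`
containing the image of `l₀` (the level function field), finite sets `S ⊆ image of l₀` and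
`Y ⊆ F₁^h` with `Y` separable over `k(S)`. Conclusion: a primitive constant `y₀ ∈ F₁^h ∩ O_V`,
separable and `l₀°`-integral (minimal polynomial over `l₀` with coefficients in `l₀°`), with
`Y ⊆ l₀(y₀)`, and a finite Galois `M ⊇ m = l₀(y₀)` inside `\overline{m}^{Ω}` with
`M ∩ F₁^h ⊆ m` and containing every `l₀`-conjugate of every element of `m`. [folklore] -/
theorem exists_level_constants (l₀ : Type u) [Field l₀] [Algebra k l₀] [Algebra l₀ Ω]
    [IsScalarTower k l₀ Ω] (Ol₀ : ValuationSubring l₀) (hOl₀ : V.comap (algebraMap l₀ Ω) = Ol₀)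
    (F₁ : Subfield Ω) (hl₀F₁ : ∀ c : l₀, algebraMap l₀ Ω c ∈ F₁)
    (S : Finset Ω) (hS : (↑S : Set Ω) ⊆ Set.range (algebraMap l₀ Ω))
    (Y : Finset Ω) (hYh : (↑Y : Set Ω) ⊆ henselization V F₁)
    (hYsep : ∀ y ∈ Y, IsSeparable (IntermediateField.adjoin k (S : Set Ω)) y) :
    ∃ y₀ : Ω, y₀ ∈ V ∧ IsIntegral l₀ y₀ ∧ IsSeparable l₀ y₀ ∧
      (∀ i, (minpoly l₀ y₀).coeff i ∈ Ol₀) ∧ y₀ ∈ henselization V F₁ ∧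
      (↑Y : Set Ω) ⊆ IntermediateField.adjoin l₀ ({y₀} : Set Ω) ∧
      ∃ M : IntermediateField (IntermediateField.adjoin l₀ ({y₀} : Set Ω)).toSubfield
          (algebraicClosure (IntermediateField.adjoin l₀ ({y₀} : Set Ω)).toSubfield Ω),
        FiniteDimensional (IntermediateField.adjoin l₀ ({y₀} : Set Ω)).toSubfield M ∧
        IsGalois (IntermediateField.adjoin l₀ ({y₀} : Set Ω)).toSubfield M ∧
        (∀ z : M, ((z : algebraicClosure (IntermediateField.adjoin l₀ ({y₀} : Set Ω)).toSubfield Ω) : Ω)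
            ∈ henselization V F₁ →
          ((z : algebraicClosure (IntermediateField.adjoin l₀ ({y₀} : Set Ω)).toSubfield Ω) : Ω)
            ∈ (IntermediateField.adjoin l₀ ({y₀} : Set Ω)).toSubfield) ∧
        (∀ a ∈ (IntermediateField.adjoin l₀ ({y₀} : Set Ω)).toSubfield, ∀ α : Ω,
          aeval α (minpoly l₀ a) = 0 →
          ∃ z : M,
            ((z : algebraicClosure (IntermediateField.adjoin l₀ ({y₀} : Set Ω)).toSubfield Ω) : Ω)
              = α) := by
  classical
  set L : Subfield Ω := henselization V F₁ with hLdef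
  have hF₁L : F₁ ≤ L := le_henselization V F₁
  have hOkV : ∀ c ∈ Ol₀, algebraMap l₀ Ω c ∈ V := fun c hc => by
    rw [← hOl₀] at hc
    exact hc
  have hkL : ∀ c : l₀, algebraMap l₀ Ω c ∈ L := fun c => hF₁L (hl₀F₁ c)
  have hY : ∀ y ∈ Y, IsSeparable l₀ y := fun y hy =>
    isSeparable_of_range_eq l₀ (S : Set Ω) hS (hYsep y hy)
  obtain ⟨M₀, y₀, hfin, hgal, hconj, hy₀L, hy₀V, hy₀int, hy₀sep, hcoef, hYm, hmiff⟩ :=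
    exists_primitive_integral_constant (k := l₀) Ol₀ V hOkV L hkL Y hYh hY
  haveI := hfin
  haveI := hgal
  set m : Subfield Ω := (IntermediateField.adjoin l₀ ({y₀} : Set Ω)).toSubfield with hmdef
  have hmmem : ∀ z : Ω, z ∈ m ↔ z ∈ IntermediateField.adjoin l₀ ({y₀} : Set Ω) := fun _ => Iff.rfl
  have hkm : ∀ c : l₀, algebraMap l₀ Ω c ∈ m := fun c =>
    (hmmem _).mpr (IntermediateField.algebraMap_mem _ c)
  have hmM₀ : ∀ z ∈ m, z ∈ M₀ := fun z hz => ((hmiff z).mp ((hmmem z).mp hz)).1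
  have hML₀ : ∀ z ∈ M₀, z ∈ L → z ∈ m := fun z hzM hzL => (hmmem z).mpr ((hmiff z).mpr ⟨hzM, hzL⟩)
  obtain ⟨M, hMfin, hMgal, hML, hconjM⟩ :=
    exists_galois_over_constants (k := l₀) M₀ hconj m hkm hmM₀ L hML₀
  exact ⟨y₀, hy₀V, hy₀int, hy₀sep, hcoef, hy₀L, hYm, M, hMfin, hMgal, hML,
    fun a ha α hα => hconjM a ha α hα⟩

/-! ### Bookkeeping for the chart datum over the level -/

section Bookkeeping

omit [IsAlgClosed Ω]

/-- **Rank one of the level function field**: `K` of height one, `K₁ ⊇ K` and `F₁ ⊇ K₁` finite,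
all inside `(Ω, V)` ⇒ `(F₁, V ∩ F₁)` has rank one (`IsRankOneValued`; the field `hrank` of
`RelCurveChart`). [folklore] -/
theorem isRankOneValued_fieldRange_level {K K₁ F₁ : Type u} [Field K] [Field K₁] [Field F₁]
    [Algebra K K₁] [Algebra K₁ F₁] [Algebra K F₁] [IsScalarTower K K₁ F₁]
    [FiniteDimensional K K₁] [FiniteDimensional K₁ F₁] [Algebra F₁ Ω] [Algebra K Ω]
    [IsScalarTower K F₁ Ω] {O : ValuationSubring K} (hdimK : ringKrullDim O = 1)
    (hO : V.comap (algebraMap K Ω) = O) : IsRankOneValued V (algebraMap F₁ Ω).fieldRange := by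
  haveI : FiniteDimensional K F₁ := Module.Finite.trans K₁ F₁
  have hK : IsRankOneValued V (algebraMap K Ω).fieldRange :=
    isRankOneValued_fieldRange_of_ringKrullDim_eq_one V (by rw [hO]; exact hdimK)
  exact isRankOneValued_fieldRange_of_finiteDimensional (K := K) (K₁ := F₁) V hK

end Bookkeeping

/-- **The E-side inclusion over the level**: if `K₁ ≤ k(S, Y)(t)^h` and `k ∪ S ∪ Y ⊆ m`, then
`K₁ ⊔ m ≤ m(t)^h` (`Ω` algebraically closed). [folklore] -/
theorem sup_le_henselization_closure {K₁ kΩ m : Subfield Ω} {S Y : Finset Ω} {t : Ω}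
    (hk : kΩ ≤ m) (hS : (↑S : Set Ω) ⊆ m) (hY : (↑Y : Set Ω) ⊆ m)
    (hgen : K₁ ≤ henselization V (Subfield.closure ((kΩ : Set Ω) ∪ ↑S ∪ ↑Y ∪ {t}))) :
    K₁ ⊔ m ≤ henselization V (Subfield.closure ((m : Set Ω) ∪ {t})) := by
  have hle : Subfield.closure ((kΩ : Set Ω) ∪ ↑S ∪ ↑Y ∪ {t}) ≤
      Subfield.closure ((m : Set Ω) ∪ {t}) := by
    refine Subfield.closure_mono ?_
    refine Set.union_subset_union_left _ (Set.union_subset (Set.union_subset ?_ hS) hY)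
    exact fun x hx => hk hx
  have hm : m ≤ Subfield.closure ((m : Set Ω) ∪ {t}) := fun x hx =>
    Subfield.subset_closure (Or.inl hx)
  exact sup_le (hgen.trans (henselization_mono V Kuhlmann2010HenselizationIsHenselian_holds.{u} hle))
    (hm.trans (le_henselization V _))

end Literature.AlgebraicGeometry.Resolution

end
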